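import Mathlib
import Summits.QuantumFields.QCD.Theorems.WilsonQuarkChessboardBackgroundSchwarzEntry

/-!
# The reflection identity for the twisted rotated Wilson–Dirac operator (helper for `BackgroundSchwarz`)

Montvay–Münster's reflection symmetry (4.106) of the `r = 1` Wilson action under the site
reflection `Θψ_x = ψ̄_{θx} γ₀` (4.99), at the level of matrix ENTRIES and for an asymmetric,
all-directions antiperiodic `U(N)` background: for row/column indices at times `t, t'` in the
negative half (`{0} ∪ [L/2, L)`), the entry of `D'[apTw V]` equals `c · conj` of the entry of
`D'[apTw V♯]` at the reflected, transposed pair of indices, where `V♯` agrees with the reflected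
field `ΘV` on the closed positive half and the sign `c` is `±1` according to the `γ₀`-blocks of the
two spins and to whether a time-like hop crosses the antiperiodic seam `t = L - 1 → 0`
(`rotD_apTw_reflect`).  The small lemmas evaluate the twist, the reflection and `posE` in
time-slice coordinates.
-/

noncomputable section

namespace Summit.QuantumFields.QCD.Theorems.BackgroundSchwarz

open Matrix Complex Finset
open Literature.MathematicalPhysics Literature.MathematicalPhysics.QuantumLattice
  Literature.MathematicalPhysics.QuantumFieldTheory Literature.Probability.LatticeModels

variable {L N : ℕ} [NeZero L]

local notation "𝕌" => Matrix.unitaryGroup (Fin N) ℂ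
local notation "ρ₀" => Literature.MathematicalPhysics.QuantumLattice.unitaryFundamentalRep (Fin N) ℂ

/-! ## The twist, the reflection and the positive half in time-slice coordinates -/

omit [NeZero L] in
/-- The twist on a time-like link. -/
theorem apTw_cons_zero (V : GaugeConfig 4 L 𝕌) (t : ZMod L) (xs : Fin 3 → ZMod L) :
    apTw[L, V] ((Fin.cons t xs : TorusSite 4 L), (0 : Fin 4)) =
      if t.val + 1 = L then -V (Fin.cons t xs, 0) else V (Fin.cons t xs, 0) := by
  simp only [Fin.cons_zero]

omit [NeZero L] in
/-- The twist on a spatial link. -/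
theorem apTw_cons_succ (V : GaugeConfig 4 L 𝕌) (t : ZMod L) (xs : Fin 3 → ZMod L) (k : Fin 3) :
    apTw[L, V] ((Fin.cons t xs : TorusSite 4 L), k.succ) =
      if (xs k).val + 1 = L then -V (Fin.cons t xs, k.succ) else V (Fin.cons t xs, k.succ) := by
  simp only [Fin.cons_succ]

omit [NeZero L] in
/-- The reflection on a time-like link. -/
theorem Θcfg_cons_zero (V : GaugeConfig 4 L 𝕌) (t : ZMod L) (xs : Fin 3 → ZMod L) :
    Θcfg[V] ((Fin.cons t xs : TorusSite 4 L), (0 : Fin 4)) = (V (Fin.cons (-(t + 1)) xs, 0))⁻¹ := by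
  simp only [if_true, shift_cons_zero, θsite_cons]

omit [NeZero L] in
/-- The reflection on a spatial link. -/
theorem Θcfg_cons_succ (V : GaugeConfig 4 L 𝕌) (t : ZMod L) (xs : Fin 3 → ZMod L) (k : Fin 3) :
    Θcfg[V] ((Fin.cons t xs : TorusSite 4 L), k.succ) = V (Fin.cons (-t) xs, k.succ) := by
  simp only [Fin.succ_ne_zero, if_false, θsite_cons]

omit [NeZero L] in
/-- `posE` of a time-like link. -/
theorem posE_cons_zero (t : ZMod L) (xs : Fin 3 → ZMod L) :
    posE[L, (((Fin.cons t xs : TorusSite 4 L), (0 : Fin 4)) : Edge 4 L)] ↔ t.val < L / 2 := by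
  simp only [if_true, Fin.cons_zero]

omit [NeZero L] in
/-- `posE` of a spatial link. -/
theorem posE_cons_succ (t : ZMod L) (xs : Fin 3 → ZMod L) (k : Fin 3) :
    posE[L, (((Fin.cons t xs : TorusSite 4 L), k.succ) : Edge 4 L)] ↔ t.val ≤ L / 2 := by
  simp only [Fin.succ_ne_zero, if_false, Fin.cons_zero]

/-- The representative of `-(t+1)` is below `L/2` when that of `t` is at least `L/2` (`L` even). -/
theorem val_neg_add_one_lt [Fact (1 < L)] (hL2 : 2 * (L / 2) = L) {t : ZMod L} (ht : L / 2 ≤ t.val) :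
    (-(t + 1)).val < L / 2 := by
  have h := ZMod.val_lt t
  rw [val_neg_eq, val_add_one]
  split_ifs with h1 h2 h2 <;> omega

/-- The representative of `-t` is at most `L/2` when `t = 0` or that of `t` is at least `L/2`. -/
theorem val_neg_le (hL2 : 2 * (L / 2) = L) {t : ZMod L} (ht : t = 0 ∨ L / 2 ≤ t.val) : (-t).val ≤ L / 2 := by
  have h := ZMod.val_lt t
  rw [val_neg_eq]
  split_ifs with h1
  · exact Nat.zero_le _
  · rcases ht with ht | ht
    · exact absurd (by rw [ht, ZMod.val_zero]) h1
    · omega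

/-! ## Unitary colour matrices -/

/-- `ρ₀(-g) = -ρ₀(g)`. -/
theorem rep_neg (g : 𝕌) : ρ₀ (-g) = -ρ₀ g := by
  rw [unitaryFundamentalRep_apply, unitaryFundamentalRep_apply]; exact Unitary.coe_neg g

/-- `(-g)⁻¹ = -g⁻¹` in `U(N)`. -/
theorem neg_inv' (g : 𝕌) : (-g)⁻¹ = -g⁻¹ :=
  inv_eq_of_mul_eq_one_right (by rw [neg_mul_neg, mul_inv_cancel])

/-- `conj ρ₀(g)_{ba} = ρ₀(g⁻¹)_{ab}`. -/
theorem star_rep_apply (g : 𝕌) (a b : Fin N) : star (ρ₀ g b a) = ρ₀ g⁻¹ a b :=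
  unitaryRep_star_apply _ (fun g => g.2) g a b

/-- `conj ρ₀(g⁻¹)_{ba} = ρ₀(g)_{ab}`. -/
theorem star_rep_inv_apply (g : 𝕌) (a b : Fin N) : star (ρ₀ g⁻¹ b a) = ρ₀ g a b :=
  unitaryRep_star_inv_apply _ (fun g => g.2) g a b


/-! ## The reflection identity -/

omit [NeZero L] in
/-- `-a = -b + 1 ↔ b = a + 1` in `ZMod L`. -/
theorem neg_eq_neg_add_one_iff (a b : ZMod L) : -a = -b + 1 ↔ b = a + 1 := by
  constructor <;> intro h <;> linear_combination h

/-- **Reflection identity for the entries of the twisted rotated Wilson–Dirac operator.**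
Let `V♯` agree with the site-reflected field `Θcfg[V]` on the closed positive half, let the row
time `t` and the column time `t'` lie in `{0} ∪ [L/2, L)`, and let the sign `c` be the product of the
`γ₀`-signs when `t = t'`, and `∓1` according to the antiperiodic seam for an allowed time-like hop.
Then `D'[apTw V]_{(t,xs,a,σs),(t',ys,b,σ's')} = c · conj D'[apTw V♯]_{(-t',ys,b,σ's'),(-t,xs,a,σs)}`. -/
theorem rotD_apTw_reflect [Fact (1 < L)] (hL : 4 ≤ L) (hL2 : 2 * (L / 2) = L)
    (V V' : GaugeConfig 4 L 𝕌) (hV' : ∀ e : Edge 4 L, posE[L, e] → V' e = Θcfg[V] e) (m : ℝ)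
    (t t' : ZMod L) (xs ys : Fin 3 → ZMod L) (a b : Fin N) (σ s σ' s' : Fin 2) (c : ℂ)
    (ht : t = 0 ∨ L / 2 ≤ t.val) (ht' : t' = 0 ∨ L / 2 ≤ t'.val)
    (hdiag : t = t' → c = if σ = σ' then 1 else -1)
    (hfwd : t' = t + 1 → σ = 1 → σ' = 1 → L / 2 ≤ t.val ∧ c = if t.val + 1 = L then -1 else 1)
    (hbwd : t = t' + 1 → σ = 0 → σ' = 0 → L / 2 ≤ t'.val ∧ c = if t'.val + 1 = L then -1 else 1) :
    rotD[ρ₀, apTw[L, V], m] ((Fin.cons t xs : TorusSite 4 L), a, spin4[σ, s])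
        ((Fin.cons t' ys : TorusSite 4 L), b, spin4[σ', s']) =
      c * star (rotD[ρ₀, apTw[L, V'], m] ((Fin.cons (-t') ys : TorusSite 4 L), b, spin4[σ', s'])
        ((Fin.cons (-t) xs : TorusSite 4 L), a, spin4[σ, s])) := by
  have htv := ZMod.val_lt t
  have htv' := ZMod.val_lt t'
  -- the two field identities behind the time-like and the spatial hops
  have keyF : ∀ (u : ZMod L) (zs : Fin 3 → ZMod L), L / 2 ≤ u.val →
      (if (-(u + 1)).val + 1 = L then -V' ((Fin.cons (-(u + 1)) zs : TorusSite 4 L), 0)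
        else V' ((Fin.cons (-(u + 1)) zs : TorusSite 4 L), 0)) = (V (Fin.cons u zs, 0))⁻¹ := by
    intro u zs h
    have hu := ZMod.val_lt u
    rw [if_neg, hV' _ ((posE_cons_zero _ _).2 (val_neg_add_one_lt hL2 h)), Θcfg_cons_zero]
    · congr 3; ring
    · rw [val_neg_eq, val_add_one]
      split_ifs <;> omega
  have keyS : ∀ (u : ZMod L) (zs : Fin 3 → ZMod L) (k : Fin 3), (u = 0 ∨ L / 2 ≤ u.val) →
      (if (zs k).val + 1 = L then -V' ((Fin.cons (-u) zs : TorusSite 4 L), k.succ)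
        else V' ((Fin.cons (-u) zs : TorusSite 4 L), k.succ)) =
      (if (zs k).val + 1 = L then -V ((Fin.cons u zs : TorusSite 4 L), k.succ)
        else V ((Fin.cons u zs : TorusSite 4 L), k.succ)) := by
    intro u zs k hu
    rw [hV' _ ((posE_cons_succ _ _ _).2 (val_neg_le hL2 hu)), Θcfg_cons_succ, neg_neg]
  -- expand both entries
  rw [rotD_apply_cons ρ₀ (apTw[L, V]) m, rotD_apply_cons ρ₀ (apTw[L, V']) m]
  simp only [Fin.cons_zero, Fin.cons_succ]
  simp only [Complex.star_def, map_add, map_mul, map_sum, apply_ite (starRingEnd ℂ), map_zero]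
  simp only [← Complex.star_def, star_rotF_apply, star_rotG_apply, star_rep_apply, inv_inv,
    Complex.conj_ofReal]
  rw [mul_add c, mul_add c, mul_add c, Finset.mul_sum _ _ c]
  congr 1
  · -- mass term
    by_cases h : t = t' ∧ xs = ys ∧ a = b ∧ (spin4[σ, s]) = spin4[σ', s']
    · obtain ⟨h1, h2, h3, h4⟩ := h
      obtain ⟨h5, h6⟩ := spin4_inj h4
      rw [if_pos (show t = t' ∧ xs = ys ∧ a = b ∧ (spin4[σ, s]) = spin4[σ', s'] from ⟨h1, h2, h3, h4⟩),
        if_pos (show -t' = -t ∧ ys = xs ∧ b = a ∧ (spin4[σ', s']) = spin4[σ, s] from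
          ⟨by rw [h1], h2.symm, h3.symm, h4.symm⟩),
        hdiag h1, if_pos h5, one_mul]
    · rw [if_neg h, if_neg (show ¬(-t' = -t ∧ ys = xs ∧ b = a ∧ (spin4[σ', s']) = spin4[σ, s]) from
        fun h' => h ⟨(neg_inj.1 h'.1).symm, h'.2.1.symm, h'.2.2.1.symm, h'.2.2.2.symm⟩), mul_zero]
  congr 1
  · congr 1
    · -- time-like forward hop
      by_cases h : t' = t + 1 ∧ ys = xs
      · obtain ⟨h1, h2⟩ := h
        rw [if_pos (show t' = t + 1 ∧ ys = xs from ⟨h1, h2⟩),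
          if_pos (show -t = -t' + 1 ∧ xs = ys from ⟨(neg_eq_neg_add_one_iff t t').2 h1, h2.symm⟩),
          rotF_zero_spin4]
        by_cases hs : σ = 1 ∧ σ' = 1 ∧ s = s'
        · obtain ⟨hσ, hσ', hss⟩ := hs
          obtain ⟨htL, hc⟩ := hfwd h1 hσ hσ'
          rw [if_pos (show σ = 1 ∧ σ' = 1 ∧ s = s' from ⟨hσ, hσ', hss⟩), h1, h2, keyF t xs htL, inv_inv, hc]
          split_ifs
          · rw [rep_neg]; simp only [Matrix.neg_apply]; ring
          · ring
        · rw [if_neg hs, zero_mul, zero_mul, mul_zero]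
      · rw [if_neg h, if_neg (show ¬(-t = -t' + 1 ∧ xs = ys) from
          fun h' => h ⟨(neg_eq_neg_add_one_iff t t').1 h'.1, h'.2.symm⟩), mul_zero]
    · -- time-like backward hop
      by_cases h : t = t' + 1 ∧ xs = ys
      · obtain ⟨h1, h2⟩ := h
        rw [if_pos (show t = t' + 1 ∧ xs = ys from ⟨h1, h2⟩),
          if_pos (show -t' = -t + 1 ∧ ys = xs from ⟨(neg_eq_neg_add_one_iff t' t).2 h1, h2.symm⟩),
          rotG_zero_spin4]
        by_cases hs : σ = 0 ∧ σ' = 0 ∧ s = s'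
        · obtain ⟨hσ, hσ', hss⟩ := hs
          obtain ⟨htL, hc⟩ := hbwd h1 hσ hσ'
          rw [if_pos (show σ = 0 ∧ σ' = 0 ∧ s = s' from ⟨hσ, hσ', hss⟩), h1, h2, keyF t' ys htL, hc]
          split_ifs
          · rw [neg_inv', rep_neg]; simp only [Matrix.neg_apply]; ring
          · ring
        · rw [if_neg hs, zero_mul, zero_mul, mul_zero]
      · rw [if_neg h, if_neg (show ¬(-t' = -t + 1 ∧ ys = xs) from
          fun h' => h ⟨(neg_eq_neg_add_one_iff t' t).1 h'.1, h'.2.symm⟩), mul_zero]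
  · refine Finset.sum_congr rfl fun k _ => ?_
    rw [mul_add c, add_comm (c * _)]
    have hspin : t = t' → rotF[k.succ] (spin4[σ, s]) (spin4[σ', s']) =
        c * rotG[k.succ] (spin4[σ, s]) (spin4[σ', s']) ∧
        rotG[k.succ] (spin4[σ, s]) (spin4[σ', s']) = c * rotF[k.succ] (spin4[σ, s]) (spin4[σ', s']) := by
      intro h0
      have hc := hdiag h0
      by_cases hσ : σ = σ'
      · subst hσ
        rw [if_pos rfl] at hc
        rw [hc, one_mul, one_mul, rotF_spin4_same (Fin.succ_ne_zero k), rotG_spin4_same (Fin.succ_ne_zero k)]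
        exact ⟨rfl, rfl⟩
      · rw [if_neg hσ] at hc
        rw [hc, rotG_spin4_ne (Fin.succ_ne_zero k) hσ]
        constructor <;> ring
    congr 1
    · -- spatial forward hop of the row ↔ conj of the spatial backward hop of the reflected pair
      by_cases h : t' = t ∧ ys = xs + Pi.single k 1
      · obtain ⟨h1, h2⟩ := h
        rw [if_pos (show t' = t ∧ ys = xs + Pi.single k 1 from ⟨h1, h2⟩),
          if_pos (show -t' = -t ∧ ys = xs + Pi.single k 1 from ⟨by rw [h1], h2⟩),
          keyS t xs k ht, (hspin h1.symm).1, mul_assoc]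
      · rw [if_neg h, if_neg (show ¬(-t' = -t ∧ ys = xs + Pi.single k 1) from
          fun h' => h ⟨neg_inj.1 h'.1, h'.2⟩), mul_zero]
    · -- spatial backward hop
      by_cases h : t = t' ∧ xs = ys + Pi.single k 1
      · obtain ⟨h1, h2⟩ := h
        rw [if_pos (show t = t' ∧ xs = ys + Pi.single k 1 from ⟨h1, h2⟩),
          if_pos (show -t = -t' ∧ xs = ys + Pi.single k 1 from ⟨by rw [h1], h2⟩),
          keyS t' ys k ht', (hspin h1).2, mul_assoc]
      · rw [if_neg h, if_neg (show ¬(-t = -t' ∧ xs = ys + Pi.single k 1) from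
          fun h' => h ⟨neg_inj.1 h'.1, h'.2⟩), mul_zero]

end Summit.QuantumFields.QCD.Theorems.BackgroundSchwarz
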